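import Summits.SmoothPoincare4.SmoothPoincare4.Theorems.EntropyRungMargerinRailsDefs
import Summits.SmoothPoincare4.SmoothPoincare4.Theorems.EntropyRungChangGurskyYangMargerinPolynomialScalar
import Summits.SmoothPoincare4.SmoothPoincare4.Theorems.EntropyRungChangGurskyYangMargerinPolynomialMatrix
import HarnessLib

/-!
# STUB 1 `stub_margerinPolynomial` of line `margerin-cone-hamilton-rails`
# (crux `EntropyRung.ChangGurskyYang`, item stmt-SmoothPoincare4-10834): Margerin's polynomial inequality in margin form

**Margerin 1998, Prop. 4 with Lemma 5 at `β = 2`, quantitative.** For every `0 ≤ c < 1/6` there is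
`σ ∈ (0, 1]` — explicitly `σ(c) = (1 − √(6c))²/2` — such that on Margerin's weak-pinching cone
`margerinCone c` (Hamilton block triples `(A, B, C)` on the Bianchi locus with `R = tr A + tr C ≥ 0`
and `|𝒟|² = |W|² + 2|E|² ≤ c R²`) the fundamental polynomial `P₂ = R·(|𝒟|²)' − 2|𝒟|²·R'` along
Hamilton's ODE `M' = M² + M^#` satisfies `P₂ ≤ −σ·|𝒟|²·R'`, i.e. the improved pinching
`|𝒟|²/R^{2−σ}` is non-increasing inside the cone. This is the lever of the line: it feeds
`stub_pinchingPreserved` (the pinching sets ride the Ricci flow, via the tree's PROVED tensor maximum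
principle `hamilton_maximumPrinciple_curvatureODE_holds`) and hence Margerin's leaf of CGY Thm. A.

Proof (this file assembles; the algebra is in the two companion files):
`P₂ = 4Q` (`margerinP2_eq_four_mul`); with `t = tr A`, `a₂ = ‖Å‖²`, `c₂ = ‖C̊‖²`, `β = ‖B‖²`,
`ν = ‖(BBᵀ)°‖²`, the three decoupling inequalities (M1)–(M3) of the matrix file bound `Q` through the
substitution `p = √(3a₂/2)/t`, `q = √(3β)/t`, `r = √(3ν/(2β²))` by `−(2/9)t⁴·F̂(p, p_c, q, r)`
(`margerin_core`), the cone condition becomes `N = p² + p_c² + q² ≤ 6c`, and the scalar endgame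
`margerin_fhat_ge_margin` (exact Handelman/SOS certificates) gives `F̂ ≥ (1 − √(6c))²·N`. The margin
vanishes as `c → 1/6` exactly at Margerin's rigid rays `S³ × ℝ` (double zero) and `ℂP²`, `ℂP̄²`
(Prop. 28; kernel calibration `Cruxes/ChangGurskyYang/IdeasSketchR1K2.rigidRays_contact`); the statement
is FALSE off the Bianchi locus (`Cruxes/ChangGurskyYang/TriageR1K3Witness.lean`), which is why
`margerinCone` carries the symmetry and trace binders.

References: C. Margerin, Comm. Anal. Geom. 6 (1998) 21–65, Part I, Prop. 4, Lemma 5, Cor. 3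
(pp. 26–29), Prop. 28 (p. 58) [Margerin1998]; R. S. Hamilton, J. Differential Geom. 24 (1986), §6
[Hamilton1986].
-/

noncomputable section

-- every `Summit.SmoothPoincare4.SmoothPoincare4.…` name repeats the summit = sub-problem segment (D-0017 layout)
set_option linter.dupNamespace false

open Set
open scoped Matrix BigOperators

namespace Summit.SmoothPoincare4.SmoothPoincare4.Theorems.MargerinRails

open Literature.Geometry.Riemannian Literature.Geometry.Riemannian.HamiltonODE

/-! ## The real-variable core: from the decoupled invariants to the margin form -/

/-- `x² ≤ y²`, `0 ≤ y` ⇒ `x ≤ y`. [folklore] -/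
theorem le_of_sq_le_sq_of_nonneg {x y : ℝ} (h : x ^ 2 ≤ y ^ 2) (hy : 0 ≤ y) : x ≤ y :=
  (le_abs_self x).trans (abs_le_of_sq_le_sq h hy)

set_option maxHeartbeats 1000000 in -- ~40 algebraic steps with square roots; default budget is ~2× too small
/-- **The core estimate.** With `t = tr A ≥ 0`, `a₂ = ‖Å‖²`, `c₂ = ‖C̊‖²`, `β = ‖B‖²`,
`ν = ‖(BBᵀ)°‖²`, `K_A = 3 det Å`, `K_C = 3 det C̊`, `X_A = ⟨Å, BBᵀ⟩`, `X_C = ⟨C̊, BᵀB⟩`, `δ = det B`,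
the three decoupling inequalities and the cone condition `a₂ + 2β + c₂ ≤ (2/3)K t²` (`K = 6c ≤ 1`)
give `Q ≤ −((1 − √K)²/4)·(a₂ + 2β + c₂)(t² + β)`. Substituting `p = √(3a₂/2)/t`, `q = √(3β)/t`,
`r = √(3ν/(2β²))` turns the bound `Q ≤ …` into `−(2/9)t⁴ F̂(p, p_c, q, r)` and the claim into
`margerin_fhat_ge_margin`. [cite: Margerin1998, Part I, Prop. 4 and Lemma 5] -/
theorem margerin_core (t a2 c2 β ν KA KC XA XC δ K : ℝ) (ht : 0 ≤ t) (ha2 : 0 ≤ a2) (hc2 : 0 ≤ c2)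
    (hβ : 0 ≤ β) (hν : 0 ≤ ν) (hν2 : 3 * ν ≤ 2 * β ^ 2) (hKA : 6 * KA ^ 2 ≤ a2 ^ 3)
    (hKC : 6 * KC ^ 2 ≤ c2 ^ 3) (hXA : XA ^ 2 ≤ a2 * ν) (hXC : XC ^ 2 ≤ c2 * ν)
    (hδ : 108 * β * δ ^ 2 ≤ (2 * β ^ 2 - 3 * ν) ^ 2) (hδ0 : β = 0 → δ = 0) (hK1 : K ≤ 1)
    (hcone : a2 + 2 * β + c2 ≤ 2 / 3 * K * t ^ 2) :
    -(t ^ 2 * (a2 + 2 / 3 * β + c2)) - (a2 + 2 * β + c2) * β + 3 * t * (KA + KC + XA + XC + 4 * δ) ≤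
      -((1 - Real.sqrt K) ^ 2 / 4 * ((a2 + 2 * β + c2) * (t ^ 2 + β))) := by
  rcases ht.eq_or_lt with ht0 | htpos
  · -- `t = 0`: the cone condition forces everything to vanish
    subst ht0
    have hsum : a2 + 2 * β + c2 ≤ 0 := by simpa using hcone
    have ha0 : a2 = 0 := by linarith
    have hb0 : β = 0 := by linarith
    have hc0 : c2 = 0 := by linarith
    have hδ00 : δ = 0 := hδ0 hb0
    subst ha0; subst hb0; subst hc0; subst hδ00
    have hKA0 : KA = 0 := pow_eq_zero_iff (n := 2) (by norm_num) |>.mp (by nlinarith [sq_nonneg KA])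
    have hKC0 : KC = 0 := pow_eq_zero_iff (n := 2) (by norm_num) |>.mp (by nlinarith [sq_nonneg KC])
    have hXA0 : XA = 0 := pow_eq_zero_iff (n := 2) (by norm_num) |>.mp (by nlinarith [sq_nonneg XA])
    have hXC0 : XC = 0 := pow_eq_zero_iff (n := 2) (by norm_num) |>.mp (by nlinarith [sq_nonneg XC])
    subst hKA0; subst hKC0; subst hXA0; subst hXC0
    norm_num
  -- `t > 0`: the substitution
  have htne : t ≠ 0 := htpos.ne'
  set p := Real.sqrt (3 * a2 / 2) / t with hp_def
  set pc := Real.sqrt (3 * c2 / 2) / t with hpc_def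
  set q := Real.sqrt (3 * β) / t with hq_def
  set r := Real.sqrt (3 * ν / (2 * β ^ 2)) with hr_def
  have hp0 : 0 ≤ p := div_nonneg (Real.sqrt_nonneg _) ht
  have hpc0 : 0 ≤ pc := div_nonneg (Real.sqrt_nonneg _) ht
  have hq0 : 0 ≤ q := div_nonneg (Real.sqrt_nonneg _) ht
  have hr0 : 0 ≤ r := Real.sqrt_nonneg _
  have ha2e : a2 = 2 / 3 * t ^ 2 * p ^ 2 := by
    have h1 : p * t = Real.sqrt (3 * a2 / 2) := by rw [hp_def, div_mul_cancel₀ _ htne]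
    have h2 : (p * t) ^ 2 = 3 * a2 / 2 := by rw [h1, Real.sq_sqrt (by positivity)]
    linear_combination (-(2 : ℝ) / 3) * h2
  have hc2e : c2 = 2 / 3 * t ^ 2 * pc ^ 2 := by
    have h1 : pc * t = Real.sqrt (3 * c2 / 2) := by rw [hpc_def, div_mul_cancel₀ _ htne]
    have h2 : (pc * t) ^ 2 = 3 * c2 / 2 := by rw [h1, Real.sq_sqrt (by positivity)]
    linear_combination (-(2 : ℝ) / 3) * h2
  have hβe : β = t ^ 2 * q ^ 2 / 3 := by
    have h1 : q * t = Real.sqrt (3 * β) := by rw [hq_def, div_mul_cancel₀ _ htne]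
    have h2 : (q * t) ^ 2 = 3 * β := by rw [h1, Real.sq_sqrt (by positivity)]
    linear_combination (-(1 : ℝ) / 3) * h2
  have hνe : ν = 2 / 3 * β ^ 2 * r ^ 2 := by
    by_cases hb : β = 0
    · have hν0 : ν = 0 := by rw [hb] at hν2; linarith
      rw [hν0, hb]; ring
    · have hb2 : (2 * β ^ 2) ≠ 0 := by positivity
      have h2 : r ^ 2 = 3 * ν / (2 * β ^ 2) := by rw [hr_def, Real.sq_sqrt (by positivity)]
      have h3 : r ^ 2 * (2 * β ^ 2) = 3 * ν := by rw [h2, div_mul_cancel₀ _ hb2]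
      linear_combination (-(1 : ℝ) / 3) * h3
  have hr2 : r ^ 2 ≤ 1 := by
    by_cases hb : β = 0
    · rw [hr_def, hb]; simp
    · have hb2 : 0 < β ^ 2 := by positivity
      rw [hr_def, Real.sq_sqrt (by positivity), div_le_one (by positivity)]
      linarith
  have hr1 : r ≤ 1 := by nlinarith [hr2, hr0]
  -- the three bounds in the new variables
  have hKA' : KA ≤ 2 / 9 * t ^ 3 * p ^ 3 := by
    refine le_of_sq_le_sq_of_nonneg ?_ (by positivity)
    have e : (2 / 9 * t ^ 3 * p ^ 3) ^ 2 = (2 / 3 * t ^ 2 * p ^ 2) ^ 3 / 6 := by ring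
    rw [e, ← ha2e]
    linarith [hKA]
  have hKC' : KC ≤ 2 / 9 * t ^ 3 * pc ^ 3 := by
    refine le_of_sq_le_sq_of_nonneg ?_ (by positivity)
    have e : (2 / 9 * t ^ 3 * pc ^ 3) ^ 2 = (2 / 3 * t ^ 2 * pc ^ 2) ^ 3 / 6 := by ring
    rw [e, ← hc2e]
    linarith [hKC]
  have hXA' : XA ≤ 2 / 9 * t ^ 3 * p * q ^ 2 * r := by
    refine le_of_sq_le_sq_of_nonneg ?_ (by positivity)
    have e : a2 * ν = (2 / 9 * t ^ 3 * p * q ^ 2 * r) ^ 2 := by rw [ha2e, hνe, hβe]; ring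
    linarith [hXA, e]
  have hXC' : XC ≤ 2 / 9 * t ^ 3 * pc * q ^ 2 * r := by
    refine le_of_sq_le_sq_of_nonneg ?_ (by positivity)
    have e : c2 * ν = (2 / 9 * t ^ 3 * pc * q ^ 2 * r) ^ 2 := by rw [hc2e, hνe, hβe]; ring
    linarith [hXC, e]
  have hδ' : δ ≤ t ^ 3 * q ^ 3 * (1 - r ^ 2) / 27 := by
    by_cases hb : β = 0
    · have hq00 : q = 0 := by rw [hq_def, hb]; simp
      rw [hδ0 hb, hq00]; simp
    · have hbpos : 0 < β := lt_of_le_of_ne hβ (Ne.symm hb)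
      have hr2' : 0 ≤ 1 - r ^ 2 := by linarith
      refine le_of_sq_le_sq_of_nonneg ?_ (by positivity)
      -- `27 δ² ≤ β³ (1 − r²)²`
      have h1 : 108 * β * δ ^ 2 ≤ (2 * β ^ 2 - 2 * β ^ 2 * r ^ 2) ^ 2 := by
        have e : 2 * β ^ 2 - 3 * ν = 2 * β ^ 2 - 2 * β ^ 2 * r ^ 2 := by rw [hνe]; ring
        rw [← e]; exact hδ
      have h2 : 27 * δ ^ 2 ≤ β ^ 3 * (1 - r ^ 2) ^ 2 := by
        have h3 : β * (27 * δ ^ 2) ≤ β * (β ^ 3 * (1 - r ^ 2) ^ 2) := by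
          have e : (2 * β ^ 2 - 2 * β ^ 2 * r ^ 2) ^ 2 = 4 * (β * (β ^ 3 * (1 - r ^ 2) ^ 2)) := by ring
          rw [e] at h1
          linarith
        exact le_of_mul_le_mul_left h3 hbpos
      have e2 : (t ^ 3 * q ^ 3 * (1 - r ^ 2) / 27) ^ 2 = (t ^ 2 * q ^ 2 / 3) ^ 3 * (1 - r ^ 2) ^ 2 / 27 := by
        ring
      rw [e2, ← hβe]
      linarith [h2]
  -- `Q ≤ −(2/9) t⁴ F̂`
  have hQ : -(t ^ 2 * (a2 + 2 / 3 * β + c2)) - (a2 + 2 * β + c2) * β + 3 * t * (KA + KC + XA + XC + 4 * δ)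
      ≤ -(2 / 9 * t ^ 4 * (3 * p ^ 2 * (1 - p) + 3 * pc ^ 2 * (1 - pc) + q ^ 2 * (1 - q) ^ 2
        + q ^ 2 * (p ^ 2 + pc ^ 2) + 2 * q ^ 3 * r ^ 2 - 3 * (p + pc) * q ^ 2 * r)) := by
    have h3t : 0 ≤ 3 * t := by positivity
    have b1 := mul_le_mul_of_nonneg_left hKA' h3t
    have b2 := mul_le_mul_of_nonneg_left hKC' h3t
    have b3 := mul_le_mul_of_nonneg_left hXA' h3t
    have b4 := mul_le_mul_of_nonneg_left hXC' h3t
    have b5 := mul_le_mul_of_nonneg_left hδ' (by positivity : (0 : ℝ) ≤ 12 * t)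
    rw [ha2e, hc2e, hβe]
    linarith [b1, b2, b3, b4, b5]
  -- the margin form of the scalar endgame
  have hN : p ^ 2 + pc ^ 2 + q ^ 2 ≤ K := by
    have h1 : 2 / 3 * t ^ 2 * (p ^ 2 + pc ^ 2 + q ^ 2) ≤ 2 / 3 * K * t ^ 2 := by
      have h0 := hcone
      rw [ha2e, hc2e, hβe] at h0
      linarith
    have ht2 : 0 < t ^ 2 := by positivity
    by_contra hK
    have hK' : K < p ^ 2 + pc ^ 2 + q ^ 2 := lt_of_not_ge hK
    have := mul_lt_mul_of_pos_left hK' (by positivity : (0 : ℝ) < 2 / 3 * t ^ 2)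
    linarith
  have hF := margerin_fhat_ge_margin p pc q r K hp0 hpc0 hq0 hr1 hK1 hN
  -- compare the two right-hand sides
  have hq2 : q ^ 2 ≤ 1 := by nlinarith [sq_nonneg p, sq_nonneg pc]
  have ht4 : 0 ≤ t ^ 4 := by positivity
  have key : (1 - Real.sqrt K) ^ 2 / 4 * ((a2 + 2 * β + c2) * (t ^ 2 + β)) ≤
      2 / 9 * t ^ 4 * (3 * p ^ 2 * (1 - p) + 3 * pc ^ 2 * (1 - pc) + q ^ 2 * (1 - q) ^ 2
        + q ^ 2 * (p ^ 2 + pc ^ 2) + 2 * q ^ 3 * r ^ 2 - 3 * (p + pc) * q ^ 2 * r) := by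
    rw [ha2e, hc2e, hβe]
    have e1 : (1 - Real.sqrt K) ^ 2 / 4 * ((2 / 3 * t ^ 2 * p ^ 2 + 2 * (t ^ 2 * q ^ 2 / 3)
        + 2 / 3 * t ^ 2 * pc ^ 2) * (t ^ 2 + t ^ 2 * q ^ 2 / 3)) =
        t ^ 4 * ((1 - Real.sqrt K) ^ 2 * (p ^ 2 + pc ^ 2 + q ^ 2)) * (1 + q ^ 2 / 3) / 6 := by ring
    rw [e1]
    have hx : 0 ≤ t ^ 4 * ((1 - Real.sqrt K) ^ 2 * (p ^ 2 + pc ^ 2 + q ^ 2)) := by positivity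
    have e2 : t ^ 4 * ((1 - Real.sqrt K) ^ 2 * (p ^ 2 + pc ^ 2 + q ^ 2)) * (1 + q ^ 2 / 3) / 6 ≤
        t ^ 4 * ((1 - Real.sqrt K) ^ 2 * (p ^ 2 + pc ^ 2 + q ^ 2)) * (4 / 3) / 6 := by
      have h43 : 1 + q ^ 2 / 3 ≤ 4 / 3 := by linarith
      have := mul_le_mul_of_nonneg_left h43 hx
      linarith
    have e3 := mul_le_mul_of_nonneg_left hF ht4
    linarith [e2, e3]
  linarith [hQ, key]

/-! ## The registered stub -/

/-- **STUB 1 of line `margerin-cone-hamilton-rails` — MARGERIN'S POLYNOMIAL INEQUALITY IN MARGIN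
FORM (Margerin 1998, Prop. 4 with Lemma 5 at `β = 2`, quantitative version).** For every
`0 ≤ c < 1/6` there is `σ ∈ (0, 1]` — explicitly `σ(c) = (1 − √(6c))²/2` — such that on Margerin's
weak-pinching cone `margerinCone c` (Bianchi locus, `R ≥ 0`, `|𝒟|² ≤ c R²`) the fundamental polynomial
satisfies `P₂ ≤ −σ·|𝒟|²·R'`: along Hamilton's ODE the improved pinching `|𝒟|²/R^{2−σ}` is
non-increasing inside the cone. Proof: `P₂ = 4Q` (`margerinP2_eq_four_mul`); the three decoupling
inequalities (trace-free cubic bound `GurskyLeBrun.det_sq_le`, Cauchy–Schwarz against the trace-free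
part of `BBᵀ`, Newton's inequality `newton_det_sq_le`) reduce `Q` to the quartic `F̂(p, p_c, q, r)`
of `margerin_core`, and the scalar endgame `margerin_fhat_ge_margin` (exact Handelman / SOS
certificates) gives `F̂ ≥ (1 − √(6c))²·N` on the cone `N = p² + p_c² + q² ≤ 6c`. The margin vanishes
as `c → 1/6` exactly because of the rigid rays `S³ × ℝ` (double zero) and `ℂP²` on `∂C(1/6)`
(Margerin's Prop. 28; `Cruxes/ChangGurskyYang/IdeasSketchR1K2.rigidRays_contact`).
[cite: Margerin1998, Part I, Prop. 4, Lemma 5 (pp. 26–29) and Prop. 28 (p. 58)] -/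
theorem stub_margerinPolynomial :
    ∀ c : ℝ, 0 ≤ c → c < 1 / 6 → ∃ σ : ℝ, 0 < σ ∧ σ ≤ 1 ∧
      ∀ p ∈ margerinCone c, margerinP2 p ≤ -(σ * (devNormSq p * scal (field p))) := by
  intro c hc0 hc
  have h6c1 : 6 * c ≤ 1 := by linarith
  have hs1 : Real.sqrt (6 * c) ≤ 1 := Real.sqrt_le_one.mpr h6c1
  have hs0 : 0 ≤ Real.sqrt (6 * c) := Real.sqrt_nonneg _
  have hslt : Real.sqrt (6 * c) < 1 := by
    have h : Real.sqrt (6 * c) < Real.sqrt 1 := Real.sqrt_lt_sqrt (by positivity) (by linarith)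
    simpa using h
  refine ⟨(1 - Real.sqrt (6 * c)) ^ 2 / 2, ?_, ?_, ?_⟩
  · have : 0 < 1 - Real.sqrt (6 * c) := by linarith
    positivity
  · nlinarith
  rintro ⟨A, B, C⟩ ⟨hA, hC, htr, hR, hcone⟩
  change A.IsSymm at hA
  change C.IsSymm at hC
  change A.trace = C.trace at htr
  -- the invariants of the block triple
  have hscal : scal (A, B, C) = 2 * A.trace := by
    change A.trace + C.trace = 2 * A.trace
    rw [← htr]; ring
  have ht0 : 0 ≤ A.trace := by rw [hscal] at hR; linarith
  have hsf : scal (field (A, B, C)) = 2 * (A.trace ^ 2 + frobSq B) := by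
    have h1 := trace_field_fst (A, B, C)
    have h2 := trace_field_snd_snd (A, B, C)
    have h3 : (B * Bᵀ).trace = frobSq B := trace_mul_transpose_self B
    change (field (A, B, C)).1.trace + (field (A, B, C)).2.2.trace = _
    rw [h1, h2]
    change A.trace ^ 2 + (B * Bᵀ).trace + (C.trace ^ 2 + (B * Bᵀ).trace) = _
    rw [h3, ← htr]; ring
  have hdev : devNormSq (A, B, C) =
      frobSq (A - (A.trace / 3) • (1 : Matrix (Fin 3) (Fin 3) ℝ)) + 2 * frobSq B +
        frobSq (C - (A.trace / 3) • (1 : Matrix (Fin 3) (Fin 3) ℝ)) := by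
    change frobSq A + 2 * frobSq B + frobSq C - (A.trace + C.trace) ^ 2 / 6 = _
    have eA := frobSq_eq_traceFree_add A
    have eC := frobSq_eq_traceFree_add C
    rw [← htr] at eC
    rw [eA, eC, ← htr]; ring
  -- (M1) the trace-free cubic bounds
  have hKA := six_mul_sq_three_det_le hA
  have hKC : 6 * (3 * (C - (A.trace / 3) • (1 : Matrix (Fin 3) (Fin 3) ℝ)).det) ^ 2 ≤
      frobSq (C - (A.trace / 3) • (1 : Matrix (Fin 3) (Fin 3) ℝ)) ^ 3 := by
    have h := six_mul_sq_three_det_le hC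
    rwa [← htr] at h
  -- (M2) Cauchy–Schwarz against the trace-free parts of `BBᵀ`, `BᵀB`
  have hXA := frobPairing_sq_le_traceFree (trace_traceFree A) (B * Bᵀ)
  have hC0tr : (C - (A.trace / 3) • (1 : Matrix (Fin 3) (Fin 3) ℝ)).trace = 0 := by
    rw [htr]; exact trace_traceFree C
  have hXC := frobPairing_sq_le_traceFree hC0tr (Bᵀ * B)
  rw [frobSq_traceFree_transpose_mul] at hXC
  -- the anisotropy `ν` of `BBᵀ` and (M3) Newton
  have hνeq : frobSq (B * Bᵀ - ((B * Bᵀ).trace / 3) • (1 : Matrix (Fin 3) (Fin 3) ℝ)) =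
      frobSq (B * Bᵀ) - frobSq B ^ 2 / 3 := by
    rw [frobSq_traceFree, trace_mul_transpose_self]
  have hν0 : 0 ≤ frobSq (B * Bᵀ - ((B * Bᵀ).trace / 3) • (1 : Matrix (Fin 3) (Fin 3) ℝ)) :=
    frobSq_nonneg _
  have hν2 : 3 * frobSq (B * Bᵀ - ((B * Bᵀ).trace / 3) • (1 : Matrix (Fin 3) (Fin 3) ℝ)) ≤
      2 * frobSq B ^ 2 := by
    rw [hνeq]
    have := frobSq_mul_transpose_le B
    linarith
  have hδ : 108 * frobSq B * B.det ^ 2 ≤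
      (2 * frobSq B ^ 2 - 3 * frobSq (B * Bᵀ - ((B * Bᵀ).trace / 3) • (1 : Matrix (Fin 3) (Fin 3) ℝ))) ^ 2 := by
    rw [hνeq]; exact newton_det_sq_le B
  have hδ0 : frobSq B = 0 → B.det = 0 := fun h ↦ by
    rw [eq_zero_of_frobSq_eq_zero h]; simp
  -- the cone condition in the invariants (`N ≤ 6c`)
  have hcone' : frobSq (A - (A.trace / 3) • (1 : Matrix (Fin 3) (Fin 3) ℝ)) + 2 * frobSq B +
      frobSq (C - (A.trace / 3) • (1 : Matrix (Fin 3) (Fin 3) ℝ)) ≤ 2 / 3 * (6 * c) * A.trace ^ 2 := by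
    rw [← hdev]
    have h : devNormSq (A, B, C) ≤ c * scal (A, B, C) ^ 2 := hcone
    rw [hscal] at h
    linarith
  have core := margerin_core A.trace _ _ _ _ _ _ _ _ _ (6 * c) ht0 (frobSq_nonneg _) (frobSq_nonneg _)
    (frobSq_nonneg _) hν0 hν2 hKA hKC hXA hXC hδ hδ0 h6c1 hcone'
  -- assemble: `P₂ = 4Q ≤ −σ · |𝒟|² · R'`
  rw [margerinP2_eq_four_mul A B C hA hC htr, hdev, hsf]
  linarith [core]

end Summit.SmoothPoincare4.SmoothPoincare4.Theorems.MargerinRails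

end
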